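import Summits.QuantumFields.YangMills.Theorems.SelfNormalisedSkewness.Negative.SelfNormalisedSkewnessFalseOfMaxwellDominatedWindowScheme
import Literature.MathematicalPhysics.QuantumFieldTheory.LatticeGaugeProofs
import HarnessLib

/-!
# Route `BoundedSkewnessRunning`, support item S2 `WindowFromNontriviality` (stmt-QuantumFields-19899) — helper:
# the renormalised truncated lattice two-point function is `c_k²` times the bare one

Pure algebra of the renormalisation (companion of S1 `SchemeCumulantScaling`, whose three small lemmas are re-derived inline so
that this file does not depend on the route file): the smeared lattice field is affine in `(c, m)`, and a truncated two-point
function is shift-invariant and 2-homogeneous (`kappa2_affine`), so along any scheme `sch` the truncated two-point function of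
the smeared curvature at the reflected pair `(v, θv)` equals `c_k² · cruxT r sch v k` (`sq_c_mul_cruxT`), `cruxT` being the
BARE truncated two-point function of the route file.  Plus the test-function algebra the window needs: `τ₋ₜ θ = θ τₜ`, and `θ` preserves compact support and flips the sign of the time support.  No summit, no mass gap, nothing
about the window is proved here.

References: K. Osterwalder, E. Seiler, Ann. Phys. 110 (1978) (lattice Schwinger functions); Montvay–Münster §1.5.
-/

set_option autoImplicit false

noncomputable section

open MeasureTheory
open scoped SchwartzMap
open Literature.Probability.LatticeModels (box)
open Literature.MathematicalPhysics.AQFT Literature.MathematicalPhysics.QuantumLattice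
open Literature.MathematicalPhysics.QuantumFieldTheory
open Summit.QuantumFields.YangMills.Theorems.SelfNormalisedSkewness.Negative

namespace Summit.QuantumFields.YangMills.Theorems.WindowFromNontriviality

/-- ★ **The truncated two-point function is shift-invariant and 2-homogeneous**: for bounded measurable `Y₁, Y₂` on a
probability space and `Z_i = c·Y_i + e_i`, `E[Z₁Z₂] − E[Z₁]E[Z₂] = c²·(E[Y₁Y₂] − E[Y₁]E[Y₂])`. [folklore] -/
theorem kappa2_affine {Ω : Type*} [MeasurableSpace Ω] (μ : Measure Ω) [IsProbabilityMeasure μ]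
    {Y₁ Y₂ Z₁ Z₂ : Ω → ℝ} (h1 : Measurable Y₁) (h2 : Measurable Y₂) {B₁ B₂ : ℝ}
    (hb1 : ∀ ω, |Y₁ ω| ≤ B₁) (hb2 : ∀ ω, |Y₂ ω| ≤ B₂) (c e₁ e₂ : ℝ)
    (hZ1 : ∀ ω, Z₁ ω = c * Y₁ ω + e₁) (hZ2 : ∀ ω, Z₂ ω = c * Y₂ ω + e₂) :
    (∫ ω, Z₁ ω * Z₂ ω ∂μ) - (∫ ω, Z₁ ω ∂μ) * (∫ ω, Z₂ ω ∂μ) =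
      c ^ 2 * ((∫ ω, Y₁ ω * Y₂ ω ∂μ) - (∫ ω, Y₁ ω ∂μ) * (∫ ω, Y₂ ω ∂μ)) := by
  have hint : ∀ {Y : Ω → ℝ}, Measurable Y → ∀ {B : ℝ}, (∀ ω, |Y ω| ≤ B) → Integrable Y μ := fun hm B hb =>
    (integrable_const B).mono' hm.aestronglyMeasurable (ae_of_all _ fun ω => by simpa [Real.norm_eq_abs] using hb ω)
  have i1 : Integrable Y₁ μ := hint h1 hb1
  have i2 : Integrable Y₂ μ := hint h2 hb2
  have i12 : Integrable (fun ω => Y₁ ω * Y₂ ω) μ := by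
    refine hint (h1.mul h2) (B := B₁ * B₂) fun ω => ?_
    rw [abs_mul]
    exact mul_le_mul (hb1 ω) (hb2 ω) (abs_nonneg _) ((abs_nonneg _).trans (hb1 ω))
  have eZ1 : ∫ ω, Z₁ ω ∂μ = c * ∫ ω, Y₁ ω ∂μ + e₁ := by
    simp_rw [hZ1]; rw [integral_add (i1.const_mul c) (integrable_const _), integral_const_mul, integral_const]; simp
  have eZ2 : ∫ ω, Z₂ ω ∂μ = c * ∫ ω, Y₂ ω ∂μ + e₂ := by
    simp_rw [hZ2]; rw [integral_add (i2.const_mul c) (integrable_const _), integral_const_mul, integral_const]; simp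
  have eZ12 : ∫ ω, Z₁ ω * Z₂ ω ∂μ =
      c ^ 2 * (∫ ω, Y₁ ω * Y₂ ω ∂μ) + c * e₂ * (∫ ω, Y₁ ω ∂μ) + c * e₁ * (∫ ω, Y₂ ω ∂μ) + e₁ * e₂ := by
    simp_rw [hZ1, hZ2]
    have he : (fun ω => (c * Y₁ ω + e₁) * (c * Y₂ ω + e₂)) =
        fun ω => c ^ 2 * (Y₁ ω * Y₂ ω) + c * e₂ * Y₁ ω + c * e₁ * Y₂ ω + e₁ * e₂ := funext fun ω => by ring
    have k1 : Integrable (fun ω => c ^ 2 * (Y₁ ω * Y₂ ω)) μ := i12.const_mul _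
    have k2 : Integrable (fun ω => c ^ 2 * (Y₁ ω * Y₂ ω) + c * e₂ * Y₁ ω) μ := k1.add (i1.const_mul _)
    have k3 : Integrable (fun ω => c ^ 2 * (Y₁ ω * Y₂ ω) + c * e₂ * Y₁ ω + c * e₁ * Y₂ ω) μ := k2.add (i2.const_mul _)
    rw [he, integral_add k3 (integrable_const _), integral_add k2 (i2.const_mul _), integral_add k1 (i1.const_mul _),
      integral_const_mul, integral_const_mul, integral_const_mul, integral_const]
    simp
  rw [eZ12, eZ1, eZ2]
  ring

variable {G : Type} [Group G] [TopologicalSpace G] [IsTopologicalGroup G] [CompactSpace G]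
  [MeasurableSpace G] [BorelSpace G]

/-- ★★ **`c_k² · T_k(v) =` the renormalised truncated two-point function** along `sch`: for every real test function
`v`, `(sch.c F k)² · cruxT r sch v k = ⟨Φ(v)Φ(θv)⟩_k − ⟨Φ(v)⟩_k⟨Φ(θv)⟩_k` with `Φ` the smeared curvature renormalised by
`(c_k, m_k)` (the bare field of `cruxT` is `Φ` at `(1, 0)`, and `Φ_{c,m} = c·Φ_{1,0} + const`). [folklore] -/
theorem sq_c_mul_cruxT (r : LatticeRep G) (sch : SpeciesScheme (YMSpecies G)) (v : 𝓢(E4, ℝ)) (k : ℕ) :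
    sch.c r.curvature k ^ 2 * cruxT r sch v k =
      latticeSchwinger r.ρ sch (fun s => s.F) k (1 + 1) (fun _ => r.curvature) ![v, thetaTest 4 v] -
        latticeSchwinger r.ρ sch (fun s => s.F) k 1 (fun _ => r.curvature) ![v] *
          latticeSchwinger r.ρ sch (fun s => s.F) k 1 (fun _ => r.curvature) ![thetaTest 4 v] := by
  -- the bare scheme has the same lattices, spacings and couplings (`(cruxBare sch).side = sch.side` definitionally)
  have hbare : ∀ (n : ℕ) (f : Fin n → 𝓢(E4, ℝ)),
      latticeSchwinger r.ρ (cruxBare sch) (fun s => s.F) k n (fun _ => r.curvature) f =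
        ∫ U, ∏ i, smearedLatticeField r.curvature.F (box 4 (sch.L k)) (sch.a k) 1 0 (f i) (torusLift (sch.side k) U)
          ∂(wilsonMeasure (d := 4) (L := sch.side k) r.ρ (sch.β k)) := fun n f => rfl
  simp only [cruxT, hbare]
  simp only [latticeSchwinger, Fin.prod_univ_succ, Fin.prod_univ_zero, Matrix.cons_val_zero, Matrix.cons_val_succ,
    mul_one]
  haveI : IsProbabilityMeasure (wilsonMeasure (d := 4) (L := sch.side k) (G := G) r.ρ (sch.β k)) :=
    isProbabilityMeasure_wilsonMeasure (d := 4) (L := sch.side k) r.ρ r.continuous (sch.β k)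
  obtain ⟨C, hC⟩ := r.curvature.bounded
  have hYm : ∀ φ : 𝓢(E4, ℝ), Measurable fun U : GaugeConfig 4 (sch.side k) G =>
      smearedLatticeField r.curvature.F (box 4 (sch.L k)) (sch.a k) 1 0 φ (torusLift (sch.side k) U) := by
    intro φ
    unfold smearedLatticeField
    refine (Finset.measurable_sum _ fun x _ => ?_).const_mul _
    exact ((r.curvature.measurable.comp ((configShift _).measurable.comp (measurable_torusLift _))).sub_const _).const_mul _
  have hYb : ∀ (φ : 𝓢(E4, ℝ)) (U : GaugeConfig 4 (sch.side k) G),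
      |smearedLatticeField r.curvature.F (box 4 (sch.L k)) (sch.a k) 1 0 φ (torusLift (sch.side k) U)| ≤
        |sch.a k ^ 4| * ∑ x ∈ box 4 (sch.L k), |φ (sch.a k • siteToE x)| * C := by
    intro φ U
    unfold smearedLatticeField
    rw [one_mul, abs_mul]
    refine mul_le_mul_of_nonneg_left ((Finset.abs_sum_le_sum_abs _ _).trans (Finset.sum_le_sum fun x _ => ?_))
      (abs_nonneg _)
    rw [sub_zero, abs_mul]
    exact mul_le_mul_of_nonneg_left (hC _) (abs_nonneg _)
  -- the smeared field is affine in `(c, m)`: `Φ_{c,m} = c·Φ_{1,0} − c m a⁴ ∑ φ`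
  have haff : ∀ (c m : ℝ) (φ : 𝓢(E4, ℝ)) (V : LGConfig 4 G),
      smearedLatticeField r.curvature.F (box 4 (sch.L k)) (sch.a k) c m φ V =
        c * smearedLatticeField r.curvature.F (box 4 (sch.L k)) (sch.a k) 1 0 φ V +
          -(c * m * (sch.a k ^ 4 * ∑ x ∈ box 4 (sch.L k), φ (sch.a k • siteToE x))) := by
    intro c m φ V
    unfold smearedLatticeField
    simp only [sub_zero, one_mul, mul_sub, Finset.sum_sub_distrib]
    rw [← Finset.sum_mul]
    ring
  have key := kappa2_affine (wilsonMeasure (d := 4) (L := sch.side k) (G := G) r.ρ (sch.β k))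
    (hYm v) (hYm (thetaTest 4 v)) (hYb v) (hYb (thetaTest 4 v)) (sch.c r.curvature k) _ _
    (fun U => haff (sch.c r.curvature k) (sch.m r.curvature k) v _)
    (fun U => haff (sch.c r.curvature k) (sch.m r.curvature k) (thetaTest 4 v) _)
  rw [key]


/-! ## Test-function algebra of `θ` and the time shifts -/

section TestFunctions

variable {d : ℕ} [NeZero d]

/-- `τ₋ₜ(θw) = θ(τₜ w)`: shifting the reflected function back in time is reflecting the forward shift. [folklore] -/
theorem timeShiftTest_neg_thetaTest (t : ℝ) (w : 𝓢(EuclideanSpace ℝ (Fin d), ℝ)) :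
    timeShiftTest d (-t) (thetaTest d w) = thetaTest d (timeShiftTest d t w) := by
  ext y
  simp only [timeShiftTest_apply, thetaTest_apply]
  congr 1
  ext i
  simp only [map_sub, PiLp.sub_apply, timeReflection_apply, PiLp.single_apply]
  split_ifs <;> ring

/-- `θ` preserves compact support. [folklore] -/
theorem hasCompactSupport_thetaTest {w : 𝓢(EuclideanSpace ℝ (Fin d), ℝ)}
    (hw : HasCompactSupport (w : EuclideanSpace ℝ (Fin d) → ℝ)) :
    HasCompactSupport (thetaTest d w : EuclideanSpace ℝ (Fin d) → ℝ) := by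
  have heq : (thetaTest d w : EuclideanSpace ℝ (Fin d) → ℝ) =
      (w : EuclideanSpace ℝ (Fin d) → ℝ) ∘ (timeReflection d).toHomeomorph := by
    funext y
    simp [thetaTest_apply]
  rw [heq]
  exact hw.comp_homeomorph _

/-- `θ` carries positive-time support to negative-time support. [folklore] -/
theorem tsupport_thetaTest_subset_neg {w : 𝓢(EuclideanSpace ℝ (Fin d), ℝ)}
    (hw : tsupport (w : EuclideanSpace ℝ (Fin d) → ℝ) ⊆ {y | 0 < y 0}) :
    tsupport (thetaTest d w : EuclideanSpace ℝ (Fin d) → ℝ) ⊆ {y | y 0 < 0} := by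
  have hK : IsClosed ((timeReflection d) ⁻¹' tsupport (w : EuclideanSpace ℝ (Fin d) → ℝ)) :=
    (isClosed_tsupport _).preimage (timeReflection d).continuous
  have hsub : Function.support (thetaTest d w : EuclideanSpace ℝ (Fin d) → ℝ) ⊆
      (timeReflection d) ⁻¹' tsupport (w : EuclideanSpace ℝ (Fin d) → ℝ) := by
    intro y hy
    rw [Function.mem_support, thetaTest_apply] at hy
    exact subset_tsupport _ (Function.mem_support.2 hy)
  refine (closure_minimal hsub hK).trans fun y hy => ?_
  have h1 := hw hy
  simp only [Set.mem_setOf_eq, timeReflection_apply] at h1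
  simpa using h1

end TestFunctions

end Summit.QuantumFields.YangMills.Theorems.WindowFromNontriviality

end
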